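import Summits.QuantumFields.BalabanUV.Beta.GAN24.LegStepPush
import Summits.QuantumFields.BalabanUV.Beta.GAN24.Push4Nest

/-!
# `BalabanUV.Beta.GAN24.LegPushNestAux` — binder row G-an2-4 ∕ (CONV-C), W-slot, the (α-0) parity re-cut, located crux (Q-L-k₀) (RULING R-gan24p1-g36-1
# (5)(C): the carrier of the (Q-L-k₀) END): **BRICKS FOR THE NESTING OF THE THREE-LEG PUSH** (part 1 of 2; part 2 = `GAN24/LegPushNest`) — the kernel
# `Kk l` of a full-row kernel leg and its composition law `kcomp`, the BOND SWAP of the double vertex (`vertex2W r X sᵀ = vertex2W r Xᵀ s`), linearity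
# on bounded tables, the symmetrisation moved onto the table, a full-row kernel leg passing through the double vertex, and the composition of the slot legs
# `vertex2W r₁ (vertex2W r₂ X) = vertex2W (legComp r₂ r₁) X` (leaf-17's `Push4Nest.vertex2W_push₄`, table-leg half).

NOT IN PRINT; OUR BOOKKEEPING ([folklore] absolutely convergent re-bracketing over leaf-17's `Push4NestTable` ∕ `Push4NestAux`; two plumbing `def`s (`Kk`,
`kcomp`) asserting nothing; 0 cited facts, 0 `def … : Prop`, 0 sorry, 0 wall binders).  HONEST FRAMING (cell contract, verbatim): «discharging `BetaPertH`
makes Bałaban's UV stability UNCONDITIONAL — a real constructive-QFT result; it is NOT the continuum limit and NOT the Clay problem.»  HONEST DEPENDENCY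
(verbatim): «continuum YM on T⁴ ⇐ BetaPertH ∧ nine spine estimates (0/9 proved); BetaPertH ⇐ (D1) ∧ (D4) ∧ CAP+tail; G-an2-4 gates asym, D1 and NE2/3/4.»

## What is proved (generic `d`)
* §1 `Kk l` (`Kk l x′ x (inl α) f := l α x′ f x`, no multiplier rows), **`legPush_eq_comp_Kk`** (`legPush l r X s = comp (Kk l) (½•(vertex2W r X s + vertex2W r X sᵀ))`,
  definitional), `kcomp l₂ l₁` (outer `l₁` through the FIELD rows of the inner push, then the inner full row `l₂`), **`comp_Kk_Kk`** (`comp (Kk l₁) (Kk l₂) =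
  Kk (kcomp l₂ l₁)`, no summability), `summable_Kk_row`, `summable_of_klegDecay`, `abs_Kk_le`.
* §2 **`vertex2W_swap`** (`vertex2W r X ν y′ μ y = vertex2W r Xᵀ μ y ν y′`, `Push4NestTable.vertexW_comm` dominated by the table's own decay), `vertex2W_lin`
  (linearity on bounded tables for summable legs), `locStencil₂_swap` ∕ `locStencil₂_symT` (`Xᵀ`, `½•(X + Xᵀ)` are `LocStencil₂` at a third of the rate),
  `abs_le_of_locStencil₂`, **`legPush_eq_comp_Kk_symT`** (`legPush l r X s = comp (Kk l) (vertex2W r (½•(X + Xᵀ)) s)`).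
* §3 `abs_vertexW_le_of_bdd`, **`vertex2W_comp_Kk`** (`vertex2W r (comp (Kk l) ∘ T) = comp (Kk l) (vertex2W r T)` on bounded `T`; `vertexW_comp_left` twice),
  **`vertex2W_vertex2W`** (`vertex2W r₁ (vertex2W r₂ X) = vertex2W (legComp r₂ r₁) X` for localised legs and a `LocStencil₂` table).
Asserts NOTHING about Bałaban's tables; NOT (H1♮); discharges NOTHING of (Q-L) ∕ (C) ∕ «T2Shape» ∕ «T2Drift» ∕ (hW, hWall); NEVER «G-an2-4 closed» as (CONV-C);
NOT D1, NOT `BetaPertH`, NOT continuum, NOT Clay; not in print.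
Unit `b2b-balaban-gan24-formalise-leaf-01` (G-an2-4 formalisation swarm, leaf prover 01, gen 74), 2026-08-23.
-/

noncomputable section

open Finset
open scoped BigOperators
open Literature.MathematicalPhysics.QuantumFieldTheory.Balaban1983to89
open Literature.MathematicalPhysics.QuantumFieldTheory.Balaban1983to89.Beta
open B12Sec2to5 (l1 l1_nonneg)
open ExpKernelCalculus (MKer Decays comp Zl Zl_nonneg Zl_pos summable_exp_shift summable_exp_shift' tsum_exp_shift' l1_sub_triangle l1_sub_symm)
open OneStepResolventKernel (Fib)
open BalabanCompositeJets (LocStencil₂ LocStencil₂.nonneg summable_slice_of_locStencil₂)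
open KernelWard (comp_assoc_of_bound comp_sub_right)
open Summit.QuantumFields.BalabanUV.Beta.GAN24.BiStencilZeroMode (Tab)
open Summit.QuantumFields.BalabanUV.Beta.GAN24.Push4 (legComp legComp_apply vertexW vertexW_apply vertex2W)
open Summit.QuantumFields.BalabanUV.Beta.GAN24.Push4Bounds (LegDecay LegDecay.nonneg LegDecay.abs_le LegDecay.summable)
open Summit.QuantumFields.BalabanUV.Beta.GAN24.Push4NestTable (vertexW_vertexW vertexW_comp_left vertexW_comm vertexW_congr)
open Summit.QuantumFields.BalabanUV.Beta.GAN24.Push4NestAux (abs_vertexW_slice_le summable_vertexW_slice decays_vertex2W_of_bdd abs_le_of_decays legDecay_legComp)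
open Summit.QuantumFields.BalabanUV.Beta.GAN24.LegStepPush (legPush legPush_inl legPush_inr vertex2W_entry)

namespace Summit.QuantumFields.BalabanUV.Beta.GAN24.LegPushNestAux

variable {d : ℕ}

/-! ## §1 The kernel of a full-row kernel leg and its composition law -/

/-- [folklore] Plumbing `def`: **THE KERNEL OF A FULL-ROW KERNEL LEG** — `Kk l x′ x (inl α) f := l α x′ f x`, multiplier rows `0`. -/
def Kk (l : Fin (d + 1) → (Fin (d + 1) → ℤ) → Fib d → (Fin (d + 1) → ℤ) → ℝ) : MKer (d + 1) (Fib d) :=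
  fun x' x a f =>
    match a with
    | Sum.inl α => l α x' f x
    | Sum.inr _ => 0

/-- [folklore] Plumbing `def`: **THE COMPOSITE KERNEL LEG** (outer `l₁`, coarse; inner `l₂`, fine): `kcomp l₂ l₁ α x″ f x := Σ'_{x′} Σ_{α′} l₁ α x″ (inl α′) x′ · l₂ α′ x′ f x`
— the outer leg reads the FIELD rows of the inner push (which has no multiplier rows), the inner leg reads all rows of the table. -/
def kcomp (l₂ l₁ : Fin (d + 1) → (Fin (d + 1) → ℤ) → Fib d → (Fin (d + 1) → ℤ) → ℝ)
    (α : Fin (d + 1)) (x'' : Fin (d + 1) → ℤ) (f : Fib d) (x : Fin (d + 1) → ℤ) : ℝ :=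
  ∑' x' : Fin (d + 1) → ℤ, ∑ α' : Fin (d + 1), l₁ α x'' (Sum.inl α') x' * l₂ α' x' f x

variable (l l₁ l₂ : Fin (d + 1) → (Fin (d + 1) → ℤ) → Fib d → (Fin (d + 1) → ℤ) → ℝ)
  (r r₁ r₂ : Fin (d + 1) → (Fin (d + 1) → ℤ) → Fin (d + 1) → (Fin (d + 1) → ℤ) → ℝ)

/-- [folklore] `Kk`: field rows. -/
@[simp] theorem Kk_inl (x' x : Fin (d + 1) → ℤ) (α : Fin (d + 1)) (f : Fib d) : Kk l x' x (Sum.inl α) f = l α x' f x := rfl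

/-- [folklore] `Kk`: multiplier rows vanish. -/
@[simp] theorem Kk_inr (x' x : Fin (d + 1) → ℤ) (ν : Fin (d + 1)) (f : Fib d) : Kk l x' x (Sum.inr ν) f = 0 := rfl

/-- [folklore] **`legPush` IS THE COMPOSITION OF `Kk l` WITH THE SYMMETRISED DOUBLE VERTEX** (definitional):
`legPush l r X κ u κ′ u′ = comp (Kk l) (½•(vertex2W r X κ u κ′ u′ + vertex2W r X κ′ u′ κ u))`. -/
theorem legPush_eq_comp_Kk (X : Tab d) (κ : Fin (d + 1)) (u : Fin (d + 1) → ℤ) (κ' : Fin (d + 1)) (u' : Fin (d + 1) → ℤ) :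
    legPush l r X κ u κ' u' = comp (Kk l) ((1 / 2 : ℝ) • (vertex2W r X κ u κ' u' + vertex2W r X κ' u' κ u)) := by
  funext x' p a b
  rcases a with α | ν
  · rw [legPush_inl]
    simp only [comp, Kk_inl, Pi.smul_apply, Pi.add_apply, smul_eq_mul]
  · rw [legPush_inr]
    simp only [comp, Kk_inr, zero_mul, Finset.sum_const_zero, tsum_zero]

/-- [folklore] **FULL-ROW KERNEL LEGS COMPOSE BY `kcomp`** — `comp (Kk l₁) (Kk l₂) = Kk (kcomp l₂ l₁)` (no summability: the multiplier middle fibres meet the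
vanishing multiplier rows of `Kk l₂`). -/
theorem comp_Kk_Kk : comp (Kk l₁) (Kk l₂) = Kk (kcomp l₂ l₁) := by
  funext x'' x a f
  rcases a with α | ν
  · simp only [comp, Kk_inl, kcomp]
    refine tsum_congr fun x' => ?_
    rw [Fintype.sum_sum_type]
    simp only [Kk_inl, Kk_inr, mul_zero, Finset.sum_const_zero, add_zero]
  · simp only [comp, Kk_inr, zero_mul, Finset.sum_const_zero, tsum_zero]

variable {l l₁ l₂ r r₁ r₂} {N N₁ N₂ : ℕ} {Cl Cl₁ Cl₂ Cr Cr₁ Cr₂ m m₁ m₂ C δ : ℝ} {X : Tab d}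

/-- [folklore] The rows of `Kk l` are summable when the leg is. -/
theorem summable_Kk_row (hl : ∀ α x' f, Summable fun x => l α x' f x) (x' : Fin (d + 1) → ℤ) (a f : Fib d) :
    Summable fun x => Kk l x' x a f := by
  rcases a with α | ν
  · exact (hl α x' f).congr fun x => by rw [Kk_inl]
  · exact summable_zero.congr fun x => by rw [Kk_inr]

/-- [folklore] A localised full-row leg: summable slices. -/
theorem summable_of_klegDecay (hl : ∀ α x' f x, |l α x' f x| ≤ Cl * Real.exp (-m * l1 (x - (N : ℤ) • x'))) (hm : 0 < m)
    (α : Fin (d + 1)) (x' : Fin (d + 1) → ℤ) (f : Fib d) : Summable fun x => l α x' f x :=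
  Summable.of_norm_bounded ((summable_exp_shift' hm ((N : ℤ) • x')).mul_left Cl) fun x => by rw [Real.norm_eq_abs]; exact hl α x' f x

/-- [folklore] The entries of `Kk l` under the leg's decay: `|Kk l x′ x a f| ≤ Cl·e^{−m|x − N•x′|₁}`. -/
theorem abs_Kk_le (hl : ∀ α x' f x, |l α x' f x| ≤ Cl * Real.exp (-m * l1 (x - (N : ℤ) • x'))) (x' x : Fin (d + 1) → ℤ) (a f : Fib d) :
    |Kk l x' x a f| ≤ Cl * Real.exp (-m * l1 (x - (N : ℤ) • x')) := by
  have hCl : 0 ≤ Cl := by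
    have h0 := hl 0 0 (Sum.inl 0) ((N : ℤ) • (0 : Fin (d + 1) → ℤ))
    rw [sub_self, show l1 (0 : Fin (d + 1) → ℤ) = 0 by simp [l1], mul_zero, Real.exp_zero, mul_one] at h0
    exact (abs_nonneg _).trans h0
  rcases a with α | ν
  · rw [Kk_inl]; exact hl α x' f x
  · rw [Kk_inr, abs_zero]; positivity

/-! ## §2 The bond swap, linearity, and the symmetrisation moved onto the table -/

/-- [folklore] **THE BOND-SWAPPED DOUBLE VERTEX IS THE DOUBLE VERTEX OF THE SLOT-SWAPPED TABLE**:
`vertex2W r X ν y′ μ y = vertex2W r (fun κ u κ′ u′ ↦ X κ′ u′ κ u) μ y ν y′` (summable bounded legs; the interchange of the two slot sums is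
`Push4NestTable.vertexW_comm`, dominated by the table's own `LocStencil₂` decay). -/
theorem vertex2W_swap (hrs : ∀ μ y κ, Summable fun u => r μ y κ u) (hrb : ∀ μ y κ u, |r μ y κ u| ≤ Cr) (hX : LocStencil₂ X C δ) (hδ : 0 < δ)
    (μ : Fin (d + 1)) (y : Fin (d + 1) → ℤ) (ν : Fin (d + 1)) (y' : Fin (d + 1) → ℤ) :
    vertex2W r X ν y' μ y = vertex2W r (fun κ u κ' u' => X κ' u' κ u) μ y ν y' := by
  have hC : 0 ≤ C := hX.nonneg
  show vertexW r (fun l' v' => vertexW r (fun κ u => X l' v' κ u) μ y) ν y' = vertexW r (fun κ u => vertexW r (fun l' v' => X l' v' κ u) ν y') μ y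
  refine vertexW_comm (G := fun κ u l' v' => X l' v' κ u) (fun l' => hrs ν y' l') (fun κ u => hrb μ y κ u) fun κ x z a b => ?_
  refine ⟨fun u => C * Real.exp (-δ * l1 (x - u)), (summable_exp_shift hδ x).mul_left C, fun u l' v' => ?_⟩
  refine (hX l' v' κ u x z a b).trans ?_
  rw [mul_assoc]
  refine mul_le_mul_of_nonneg_left ?_ hC
  rw [← Real.exp_add, Real.exp_le_exp]
  have h1 := l1_sub_triangle x v' u
  have h2 := l1_sub_symm u v'
  have h3 := l1_nonneg (z - v'); have h4 := l1_nonneg (u - v')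
  nlinarith

/-- [folklore] **LINEARITY OF THE DOUBLE VERTEX ON BOUNDED TABLES** (summable bounded legs):
`vertex2W r (c•(A + B)) μ y ν y′ = c•(vertex2W r A μ y ν y′ + vertex2W r B μ y ν y′)`. -/
theorem vertex2W_lin {A B : Tab d} {CA CB : ℝ} (hrs : ∀ μ y κ, Summable fun u => r μ y κ u)
    (hA : ∀ κ u κ' u' x z a b, |A κ u κ' u' x z a b| ≤ CA) (hB : ∀ κ u κ' u' x z a b, |B κ u κ' u' x z a b| ≤ CB) (c : ℝ)
    (μ : Fin (d + 1)) (y : Fin (d + 1) → ℤ) (ν : Fin (d + 1)) (y' : Fin (d + 1) → ℤ) :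
    vertex2W r (fun κ u κ' u' => c • (A κ u κ' u' + B κ u κ' u')) μ y ν y' = c • (vertex2W r A μ y ν y' + vertex2W r B μ y ν y') := by
  have hCA : 0 ≤ CA := (abs_nonneg _).trans (hA 0 0 0 0 0 0 (Sum.inl 0) (Sum.inl 0))
  have hCB : 0 ≤ CB := (abs_nonneg _).trans (hB 0 0 0 0 0 0 (Sum.inl 0) (Sum.inl 0))
  funext x z a b
  simp only [vertex2W, vertexW_apply, Pi.smul_apply, Pi.add_apply, smul_eq_mul]
  -- summability of a leg against a bounded slice
  have hsum : ∀ (μ₀ : Fin (d + 1)) (y₀ : Fin (d + 1) → ℤ) (κ₀ : Fin (d + 1)) (F : (Fin (d + 1) → ℤ) → ℝ) (M : ℝ),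
      (∀ u, |F u| ≤ M) → Summable fun u => r μ₀ y₀ κ₀ u * F u := by
    intro μ₀ y₀ κ₀ F M hF
    refine Summable.of_norm_bounded ((hrs μ₀ y₀ κ₀).abs.mul_right M) fun u => ?_
    rw [Real.norm_eq_abs, abs_mul]
    exact mul_le_mul_of_nonneg_left (hF u) (abs_nonneg _)
  -- the inner slot
  have hin : ∀ κ u, (∑ κ', ∑' u', r ν y' κ' u' * (c * (A κ u κ' u' x z a b + B κ u κ' u' x z a b)))
      = c * ((∑ κ', ∑' u', r ν y' κ' u' * A κ u κ' u' x z a b) + ∑ κ', ∑' u', r ν y' κ' u' * B κ u κ' u' x z a b) := by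
    intro κ u
    rw [mul_add, Finset.mul_sum, Finset.mul_sum, ← Finset.sum_add_distrib]
    refine Finset.sum_congr rfl fun κ' _ => ?_
    rw [← tsum_mul_left, ← tsum_mul_left, ← (hsum ν y' κ' _ CA (fun u' => hA κ u κ' u' x z a b)).mul_left c |>.tsum_add
      ((hsum ν y' κ' _ CB (fun u' => hB κ u κ' u' x z a b)).mul_left c)]
    exact tsum_congr fun u' => by ring
  simp_rw [hin]
  -- the inner sums are bounded uniformly in the outer slot position
  have hMr : ∀ κ', 0 ≤ ∑' u', |r ν y' κ' u'| := fun κ' => tsum_nonneg fun u' => abs_nonneg _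
  have hbdA : ∀ κ u, |∑ κ', ∑' u', r ν y' κ' u' * A κ u κ' u' x z a b| ≤ ∑ κ', (∑' u', |r ν y' κ' u'|) * CA := by
    intro κ u
    refine (Finset.abs_sum_le_sum_abs _ _).trans (Finset.sum_le_sum fun κ' _ => ?_)
    have hs := (hrs ν y' κ').abs.mul_right CA
    have hb := tsum_of_norm_bounded hs.hasSum (f := fun u' => r ν y' κ' u' * A κ u κ' u' x z a b) fun u' => by
      rw [Real.norm_eq_abs, abs_mul]; exact mul_le_mul_of_nonneg_left (hA κ u κ' u' x z a b) (abs_nonneg _)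
    rw [Real.norm_eq_abs, tsum_mul_right] at hb
    exact hb
  have hbdB : ∀ κ u, |∑ κ', ∑' u', r ν y' κ' u' * B κ u κ' u' x z a b| ≤ ∑ κ', (∑' u', |r ν y' κ' u'|) * CB := by
    intro κ u
    refine (Finset.abs_sum_le_sum_abs _ _).trans (Finset.sum_le_sum fun κ' _ => ?_)
    have hs := (hrs ν y' κ').abs.mul_right CB
    have hb := tsum_of_norm_bounded hs.hasSum (f := fun u' => r ν y' κ' u' * B κ u κ' u' x z a b) fun u' => by
      rw [Real.norm_eq_abs, abs_mul]; exact mul_le_mul_of_nonneg_left (hB κ u κ' u' x z a b) (abs_nonneg _)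
    rw [Real.norm_eq_abs, tsum_mul_right] at hb
    exact hb
  -- the outer slot
  rw [mul_add, Finset.mul_sum, Finset.mul_sum, ← Finset.sum_add_distrib]
  refine Finset.sum_congr rfl fun κ _ => ?_
  rw [← tsum_mul_left, ← tsum_mul_left, ← ((hsum μ y κ _ _ (hbdA κ)).mul_left c).tsum_add ((hsum μ y κ _ _ (hbdB κ)).mul_left c)]
  exact tsum_congr fun u => by ring

/-- [folklore] **THE SLOT-SWAPPED TABLE IS `LocStencil₂` AT A THIRD OF THE RATE** (its decay is centred at what is now the second slot; triangle inequality). -/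
theorem locStencil₂_swap (hX : LocStencil₂ X C δ) (hδ : 0 ≤ δ) : LocStencil₂ (fun κ u κ' u' => X κ' u' κ u) C (δ / 3) := by
  have hC : 0 ≤ C := hX.nonneg
  intro κ u κ' u' x z a b
  refine (hX κ' u' κ u x z a b).trans ?_
  rw [mul_assoc, mul_assoc]
  refine mul_le_mul_of_nonneg_left ?_ hC
  rw [← Real.exp_add, ← Real.exp_add, Real.exp_le_exp]
  have h1 := l1_sub_triangle x u' u
  have h2 := l1_sub_triangle z u' u
  have h3 := l1_sub_symm u u'
  have h4 := l1_nonneg (u - u'); have h5 := l1_nonneg (x - u'); have h6 := l1_nonneg (z - u')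
  nlinarith

/-- [folklore] The symmetrised table `½•(X + Xᵀ)` is `LocStencil₂` at a third of the rate. -/
theorem locStencil₂_symT (hX : LocStencil₂ X C δ) (hδ : 0 ≤ δ) :
    LocStencil₂ (fun κ u κ' u' => (1 / 2 : ℝ) • (X κ u κ' u' + X κ' u' κ u)) C (δ / 3) := by
  have hC : 0 ≤ C := hX.nonneg
  have hXs := locStencil₂_swap hX hδ
  intro κ u κ' u' x z a b
  simp only [Pi.smul_apply, Pi.add_apply, smul_eq_mul]
  have h1 : |X κ u κ' u' x z a b| ≤ C * Real.exp (-(δ / 3) * l1 (u' - u)) * Real.exp (-(δ / 3) * (l1 (x - u) + l1 (z - u))) := by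
    refine (hX κ u κ' u' x z a b).trans ?_
    rw [mul_assoc, mul_assoc]
    refine mul_le_mul_of_nonneg_left ?_ hC
    rw [← Real.exp_add, ← Real.exp_add, Real.exp_le_exp]
    have := l1_nonneg (u' - u); have := l1_nonneg (x - u); have := l1_nonneg (z - u)
    nlinarith
  have h2 := hXs κ u κ' u' x z a b
  rw [abs_mul, abs_of_pos (by norm_num : (0 : ℝ) < 1 / 2)]
  have h12 := (abs_add_le _ _).trans (add_le_add h1 h2)
  linarith

/-- [folklore] The entries of a `LocStencil₂` table are bounded by its constant. -/
theorem abs_le_of_locStencil₂ (hX : LocStencil₂ X C δ) (hδ : 0 ≤ δ) (κ : Fin (d + 1)) (u : Fin (d + 1) → ℤ) (κ' : Fin (d + 1)) (u' : Fin (d + 1) → ℤ)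
    (x z : Fin (d + 1) → ℤ) (a b : Fib d) : |X κ u κ' u' x z a b| ≤ C := by
  have hC : 0 ≤ C := hX.nonneg
  refine (hX κ u κ' u' x z a b).trans ?_
  have e1 : Real.exp (-δ * l1 (u' - u)) ≤ 1 := by rw [Real.exp_le_one_iff]; nlinarith [l1_nonneg (u' - u)]
  have e2 : Real.exp (-δ * (l1 (x - u) + l1 (z - u))) ≤ 1 := by
    rw [Real.exp_le_one_iff]; nlinarith [l1_nonneg (x - u), l1_nonneg (z - u)]
  calc C * Real.exp (-δ * l1 (u' - u)) * Real.exp (-δ * (l1 (x - u) + l1 (z - u))) ≤ C * 1 * 1 := by gcongr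
    _ = C := by ring

/-- [folklore] **THE SYMMETRISATION MOVES ONTO THE TABLE**: `legPush l r X s = comp (Kk l) (vertex2W r (½•(X + Xᵀ)) s)` (summable bounded legs,
`LocStencil₂` table). -/
theorem legPush_eq_comp_Kk_symT (hrs : ∀ μ y κ, Summable fun u => r μ y κ u) (hrb : ∀ μ y κ u, |r μ y κ u| ≤ Cr)
    (hX : LocStencil₂ X C δ) (hδ : 0 < δ) (κ : Fin (d + 1)) (u : Fin (d + 1) → ℤ) (κ' : Fin (d + 1)) (u' : Fin (d + 1) → ℤ) :
    legPush l r X κ u κ' u' = comp (Kk l) (vertex2W r (fun μ y ν y' => (1 / 2 : ℝ) • (X μ y ν y' + X ν y' μ y)) κ u κ' u') := by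
  rw [legPush_eq_comp_Kk, vertex2W_swap hrs hrb hX hδ κ u κ' u',
    vertex2W_lin (A := X) (B := fun μ y ν y' => X ν y' μ y) hrs (fun κ u κ' u' x z a b => abs_le_of_locStencil₂ hX hδ.le κ u κ' u' x z a b)
      (fun κ u κ' u' x z a b => abs_le_of_locStencil₂ hX hδ.le κ' u' κ u x z a b)]

/-! ## §3 The kernel leg passes through the double vertex; the slot legs compose -/

/-- [folklore] A summable leg against a bounded family gives a bounded vertex: `|vertexW r T ν y′ w z f b| ≤ (Σ_{κ′} Σ'_{u′} |r ν y′ κ′ u′|)·CT`. -/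
theorem abs_vertexW_le_of_bdd {T : Fin (d + 1) → (Fin (d + 1) → ℤ) → MKer (d + 1) (Fib d)} {CT : ℝ}
    (hrs : ∀ μ y κ, Summable fun u => r μ y κ u) (hT : ∀ lam v w z f b, |T lam v w z f b| ≤ CT)
    (ν : Fin (d + 1)) (y' : Fin (d + 1) → ℤ) (w z : Fin (d + 1) → ℤ) (f b : Fib d) :
    |vertexW r T ν y' w z f b| ≤ (∑ κ', ∑' u', |r ν y' κ' u'|) * CT := by
  rw [vertexW_apply, Finset.sum_mul]
  refine (Finset.abs_sum_le_sum_abs _ _).trans (Finset.sum_le_sum fun κ' _ => ?_)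
  have hs := (hrs ν y' κ').abs.mul_right CT
  have hb := tsum_of_norm_bounded hs.hasSum (f := fun u' => r ν y' κ' u' * T κ' u' w z f b) fun u' => by
    rw [Real.norm_eq_abs, abs_mul]; exact mul_le_mul_of_nonneg_left (hT κ' u' w z f b) (abs_nonneg _)
  rw [Real.norm_eq_abs, tsum_mul_right] at hb
  exact hb

/-- [folklore] **A FULL-ROW KERNEL LEG PASSES THROUGH THE DOUBLE VERTEX**: for summable slot legs, a row-summable kernel leg and a bounded table,
`vertex2W r (fun s ↦ comp (Kk l) (T s)) μ y ν y′ = comp (Kk l) (vertex2W r T μ y ν y′)` (`Push4NestTable.vertexW_comp_left` twice). -/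
theorem vertex2W_comp_Kk {T : Tab d} {CT : ℝ} (hrs : ∀ μ y κ, Summable fun u => r μ y κ u) (hl : ∀ α x' f, Summable fun x => l α x' f x)
    (hT : ∀ κ u κ' u' w z f b, |T κ u κ' u' w z f b| ≤ CT) (μ : Fin (d + 1)) (y : Fin (d + 1) → ℤ) (ν : Fin (d + 1)) (y' : Fin (d + 1) → ℤ) :
    vertex2W r (fun κ u κ' u' => comp (Kk l) (T κ u κ' u')) μ y ν y' = comp (Kk l) (vertex2W r T μ y ν y') := by
  have hA : ∀ x a f, Summable fun w => Kk l x w a f := fun x a f => summable_Kk_row hl x a f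
  -- inner slot
  have e1 : ∀ κ u, vertexW r (fun κ' u' => comp (Kk l) (T κ u κ' u')) ν y' = comp (Kk l) (vertexW r (T κ u) ν y') :=
    fun κ u => vertexW_comp_left (fun lam => hrs ν y' lam) hA (fun lam v w z f b => hT κ u lam v w z f b)
  show vertexW r (fun κ u => vertexW r (fun κ' u' => comp (Kk l) (T κ u κ' u')) ν y') μ y = comp (Kk l) (vertexW r (fun κ u => vertexW r (T κ u) ν y') μ y)
  rw [vertexW_congr (r := r) (fun κ u => e1 κ u) μ y]
  -- outer slot
  exact vertexW_comp_left (fun lam => hrs μ y lam) hA (fun lam v w z f b => abs_vertexW_le_of_bdd hrs (fun l' v' w z f b => hT lam v l' v' w z f b) ν y' w z f b)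

/-- [folklore] **THE SLOT LEGS COMPOSE** (the table-leg half of leaf-17's `Push4Nest.vertex2W_push₄`): for leg families localised at positive rates — `r₁` at
blocking `N₁` (outer), `r₂` at `N₂` (inner) — and a `LocStencil₂` table, `vertex2W r₁ (vertex2W r₂ X) μ y ν y′ = vertex2W (legComp r₂ r₁) X μ y ν y′`. -/
theorem vertex2W_vertex2W (hr₁ : LegDecay r₁ N₁ Cr₁ m₁) (hr₂ : LegDecay r₂ N₂ Cr₂ m₂) (hm₁ : 0 < m₁) (hm₂ : 0 < m₂) (hX : LocStencil₂ X C δ) (hδ : 0 < δ)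
    (μ : Fin (d + 1)) (y : Fin (d + 1) → ℤ) (ν : Fin (d + 1)) (y' : Fin (d + 1) → ℤ) :
    vertex2W r₁ (vertex2W r₂ X) μ y ν y' = vertex2W (legComp r₂ r₁) X μ y ν y' := by
  have hC := hX.nonneg
  have hCr₁ := hr₁.nonneg
  have hCr₂ := hr₂.nonneg
  have hZδ := Zl_nonneg (D := d + 1) hδ
  have hr₁s : ∀ μ₀ y₀ lam, Summable fun v => r₁ μ₀ y₀ lam v := fun μ₀ y₀ lam => hr₁.summable hm₁ μ₀ y₀ lam
  have hr₂b : ∀ lam v κ u, |r₂ lam v κ u| ≤ Cr₂ := fun lam v κ u => hr₂.abs_le hm₂.le lam v κ u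
  -- the composite legs are localised, hence bounded
  set R := legComp r₂ r₁ with hRdef
  obtain ⟨m', hm'0, hm'₂, hm'₁⟩ : ∃ m' : ℝ, 0 < m' ∧ m' ≤ m₂ ∧ m' * N₂ < m₁ := by
    refine ⟨min m₂ (m₁ / (2 * ((N₂ : ℝ) + 1))), lt_min hm₂ (by positivity), min_le_left _ _, ?_⟩
    have hN : (0 : ℝ) ≤ N₂ := Nat.cast_nonneg _
    have hpos : (0 : ℝ) < 2 * ((N₂ : ℝ) + 1) := by positivity
    have h1 : min m₂ (m₁ / (2 * ((N₂ : ℝ) + 1))) * N₂ ≤ m₁ / (2 * ((N₂ : ℝ) + 1)) * N₂ :=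
      mul_le_mul_of_nonneg_right (min_le_right _ _) hN
    have h2 : m₁ / (2 * ((N₂ : ℝ) + 1)) * N₂ < m₁ := by
      calc m₁ / (2 * ((N₂ : ℝ) + 1)) * N₂ < m₁ / (2 * ((N₂ : ℝ) + 1)) * (2 * ((N₂ : ℝ) + 1)) :=
            mul_lt_mul_of_pos_left (by linarith) (div_pos hm₁ hpos)
        _ = m₁ := div_mul_cancel₀ _ hpos.ne'
    exact h1.trans_lt h2
  have hR : LegDecay R (N₂ * N₁) ((d + 1 : ℕ) * (Cr₁ * Cr₂ * Zl (d + 1) (m₁ - m' * N₂))) m' :=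
    legDecay_legComp hr₁ hr₂ hm'0.le hm'₂ hm'₁
  set CR : ℝ := (d + 1 : ℕ) * (Cr₁ * Cr₂ * Zl (d + 1) (m₁ - m' * N₂)) with hCRdef
  have hCR : 0 ≤ CR := hR.nonneg
  have hRb : ∀ μ₀ y₀ κ u, |R μ₀ y₀ κ u| ≤ CR := fun μ₀ y₀ κ u => hR.abs_le hm'0.le μ₀ y₀ κ u
  -- at a fixed middle bond: commute the outer second-slot leg past the inner first-slot leg, then merge on the second slot
  have A1 : ∀ (lam : Fin (d + 1)) (v : Fin (d + 1) → ℤ),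
      vertexW r₁ (fun l' v' => vertex2W r₂ X lam v l' v') ν y' = vertexW r₂ (fun κ u => vertexW R (X κ u) ν y') lam v := by
    intro lam v
    have e3 : vertexW r₁ (fun l' v' => vertex2W r₂ X lam v l' v') ν y'
        = vertexW r₂ (fun κ u => vertexW r₁ (fun l' v' => vertexW r₂ (X κ u) l' v') ν y') lam v := by
      have hG : ∀ κ x z a b, ∃ g : (Fin (d + 1) → ℤ) → ℝ, Summable g ∧
          ∀ u l' v', |vertexW r₂ (X κ u) l' v' x z a b| ≤ g u := by
        intro κ x z a b
        refine ⟨fun u => (d + 1 : ℕ) * (Cr₂ * (C * Zl (d + 1) δ)) * Real.exp (-δ * (l1 (x - u) + l1 (z - u))), ?_,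
          fun u l' v' => abs_vertexW_slice_le (fun μ₀ y₀ κ u => hr₂b μ₀ y₀ κ u) hCr₂ hX hδ κ u l' v' x z a b⟩
        refine Summable.of_nonneg_of_le (fun u => by positivity) (fun u => ?_)
          ((summable_exp_shift hδ x).mul_left ((d + 1 : ℕ) * (Cr₂ * (C * Zl (d + 1) δ))))
        refine mul_le_mul_of_nonneg_left (Real.exp_le_exp.2 ?_) (by positivity)
        nlinarith [l1_nonneg (z - u), l1_nonneg (x - u)]
      exact vertexW_comm (hr₁s ν y') (fun κ u => hr₂b lam v κ u) hG
    rw [e3]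
    exact vertexW_congr (fun κ u => vertexW_vertexW (hr₁s ν y') hr₂b
      (fun κ' x z a b => summable_slice_of_locStencil₂ hX hδ κ u κ' x z a b)) lam v
  -- the outer first-slot leg merges with the inner one
  show vertexW r₁ (fun lam v => vertexW r₁ (fun l' v' => vertex2W r₂ X lam v l' v') ν y') μ y = vertexW R (fun κ u => vertexW R (X κ u) ν y') μ y
  rw [vertexW_congr (r := r₁) (fun lam v => A1 lam v) μ y]
  exact vertexW_vertexW (hr₁s μ y) hr₂b (fun κ x z a b => summable_vertexW_slice hRb hCR hX hδ κ ν y' x z a b)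

end Summit.QuantumFields.BalabanUV.Beta.GAN24.LegPushNestAux

end
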